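import Literature.Computability.Cryptography.LiuPassLemma53Assembly
import Literature.Computability.Cryptography.GoldreichLevinProgram
import Literature.Computability.Cryptography.GoldreichLevinTheorem
import HarnessLib

/-!
# Liu–Pass 2020, Thm 1.1: one-way functions exist iff `K^{poly}` is mildly hard-on-average — fully proved

Final assembly for the named fact `OWFExist_iff_exists_isMildlyHardOnAverage_liuPassKt`
(`Sweep1Proofs.lean`: Liu–Pass's Thm 1.1 = Thm 3.1 (a) ⇔ (b), the `∃ t` form: for every efficient
universal machine `U`, one-way functions exist iff `K^t` is mildly hard-on-average for some
polynomial `t(n) ≥ (1+ε)n`). Every ingredient is proved in the tree: Thm 4.1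
(`weakOWFExist_of_isMildlyHardOnAverage_liuPassKt_holds`, `LiuPassHeurProgram.lean`), Yao's
amplification (`weakOWFExist_iff_OWFExist_holds`, `YaoInvProgram.lean`), Thm 5.2 / 5.6
(`LiuPassCondEPPRG.lean`, `LiuPassPaddingProofs.lean`), Thm 5.5 from Lemmas 5.3/5.4 and the
Goldreich–Levin theorem for hiding functions (`LiuPassLemma53Assembly.lean`,
`OWFExist_iff_isMildlyHardOnAverage_liuPassKt_of_GL`), the latter from the inverter `𝒜_GL`
(`GoldreichLevinInverter.lean`, `GoldreichLevinTheorem.lean`: `GLInv.goldreichLevin_hiding_len_of_eff`)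
whose efficiency is `GLInv.glInvRun_polyTime_holds` (`GoldreichLevinProgram.lean`). The per-`t` form
(crypto-foundations.S02, `OWFExist_iff_isMildlyHardOnAverage_liuPassKt`) is obtained on the way and
specialised at `t = 2X` (`OWFExist_iff_exists_isMildlyHardOnAverage_liuPassKt_of_S02`).
`Sweep1Proofs.lean` itself cannot host this theorem: the whole chain imports it.

## References

* Y. Liu, R. Pass, *On one-way functions and Kolmogorov complexity*, FOCS 2020, 1243–1254
  (doi:10.1109/FOCS46700.2020.00118; arXiv:2009.11514v1): Thm 1.1 (p. 3), Thm 3.1 and the remark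
  following it (p. 9), Thm 4.1, Thms 5.2, 5.5, 5.6, Appendix (Thm [GL89]).
-/

namespace Literature.Computability.Cryptography

/-- **Liu–Pass 2020, Thm 1.1 = Thm 3.1 (a) ⇔ (b), fully proved**: for every efficient universal
machine `U`, one-way functions exist iff `K^t` is mildly hard-on-average for some polynomial
`t(n) ≥ (1+ε)n` (`ε > 0`). Printed proof: (b) ⇒ (a) is Thm 4.1 with Yao's amplification, (a) ⇒ (c)
is §5 (Thms 5.5, 5.6, 5.2, with the Goldreich–Levin theorem), (c) ⇒ (b) is trivial; here S02 (the
per-`t` form, from the Goldreich–Levin theorem now proved) specialised at `t = 2X`, `ε = 1`.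
[Y. Liu, R. Pass, FOCS 2020, Thm 1.1 and Thm 3.1 (a) ⇔ (b); arXiv:2009.11514]
[cite: LiuPassFOCS2020, Thm 1.1 (= Thm 3.1 (a)⇔(b))] -/
theorem OWFExist_iff_exists_isMildlyHardOnAverage_liuPassKt_holds :
    OWFExist_iff_exists_isMildlyHardOnAverage_liuPassKt :=
  OWFExist_iff_exists_isMildlyHardOnAverage_liuPassKt_of_S02
    (OWFExist_iff_isMildlyHardOnAverage_liuPassKt_of_GL
      (GLInv.goldreichLevin_hiding_len_of_eff GLInv.glInvRun_polyTime_holds))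

/-- **Liu–Pass 2020, Thm 1.1, per-`t` form (crypto-foundations.S02), fully proved** — the named fact
`OWFExist_iff_isMildlyHardOnAverage_liuPassKt` of `Sweep1.lean`: for every universal machine `U`,
every polynomial `t` and `ε > 0` with `t(n) ≥ (1+ε)n`, one-way functions exist iff the `t`-bounded
Kolmogorov complexity `K^t` is mildly hard-on-average. From `OWFExist_iff_isMildlyHardOnAverage_liuPassKt_of_GL`
(`LiuPassLemma53Assembly.lean`) and the Goldreich–Levin theorem for hiding functions, proved via
`GLInv.goldreichLevin_hiding_len_of_eff` (`GoldreichLevinTheorem.lean`) and the efficiency of the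
inverter `GLInv.glInvRun_polyTime_holds` (`GoldreichLevinProgram.lean`).
[Y. Liu, R. Pass, FOCS 2020, Thm 1.1; arXiv:2009.11514] [cite: LiuPassFOCS2020, Thm 1.1] -/
theorem OWFExist_iff_isMildlyHardOnAverage_liuPassKt_holds : OWFExist_iff_isMildlyHardOnAverage_liuPassKt :=
  OWFExist_iff_isMildlyHardOnAverage_liuPassKt_of_GL
    (GLInv.goldreichLevin_hiding_len_of_eff GLInv.glInvRun_polyTime_holds)

end Literature.Computability.Cryptography
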